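import Summits.HodgeConjecture.HodgeConjecture.Theorems.HodgeLocusCensusSexticNeither

/-!
# HodgeLocusCensusSexticNeither4 — the N = 1 'NEITHER' row: the second norm exception `D' = -432` (pub-hlocus, ENGINE B, abs-2 gen 21)

HONEST FRAMING: certified instances and evidence bearing on the general Hodge conjecture; no claim.

Continuation of `HodgeLocusCensusSexticNeither{,2,3}` (generic lemmas `nonsqMod_of_signChange`, `nonsqMod_of_residue` and the statement
shape are explained in the first file).  Among all 49998 discriminants `4 < |D| ≤ 10⁵` exactly two have `H_D(0)·H_D(1728)` a perfect square,
so that the naive norm test cannot show `θ(θ − 1728) ∉ ℚ(θ)^{×2}` (`θ = j(O_D)`): `D = -203` (certified in file 2, and covered by the ramified-prime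
theorem of `data/abs/engineB/DERIVATIONS_engineB.md` §13) and `D = -432 = -3·12²` (`h = 6`), which no proved family covers.  This file kernel-certifies
`D = -432`: `x(x − 1728)` is not a square modulo `m = H_{-432}` over `ℚ` (residue witness `p = 47`, `x̄ = 44`), and — the other half of the row —
`D₀·x(x − 1728)`, `D₀ = -3`, is not (sign change of `m` right of `1728`).  `H_{-432}` computed two ways (PARI `polclass` = FLINT
`fmpz_poly.hilbert_class_poly`, kit job j105618); witness found by kit j102501 (PARI `polrootsmod` = FLINT `nmod_poly` roots) and re-checked in pure python on the hub.
-/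

namespace Summit.HodgeConjecture.HodgeConjecture.HodgeLocus.Census.SexticNeither

open Polynomial

/-- `sextic:D432:k0` (`D' = -432`, `D₀ = -3`, `h = 6`): `D₀·x(x − 1728)` is not a square modulo `H_{D'}` over `ℚ` — sign certificate `m(22804995243537595825770536115)·m(22804995243537595825770536116) < 0` (a > 1728; a real root of `m` lies in between). -/
theorem sextic_D432_k0_D0alpha_nonsq : ¬ ∃ B Q : ℚ[X], C ((-3 : ℤ) : ℚ) * (X * (X - C (1728 : ℚ))) = B ^ 2 + map (Int.castRingHom ℚ) (List.foldr (fun (c : ℤ) (P : ℤ[X]) => C c + X * P) 0 [42889619864187195342544128412237640625000000000000, 3869372376492639837782614434923625000000000000, 34904627315764077727184412247908187500000000, 1007059405271040783775694468925000000000, 280179539493990596285512318134750000, -22804995243537595825782822000, 1]) * Q := nonsqMod_of_signChange _ (-3) (22804995243537595825770536115) (22804995243537595825770536116) (by decide) (by decide) (by decide) (by decide +kernel)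

/-- `sextic:D432:k0`: `x(x − 1728)` is not a square modulo `H_{D'}` over `ℚ` — residue witness `p = 47`, `x̄ = 44` (simple root of `m` mod `p`: `m(44) ≡ 0`, `m'(44) ≡ 36`; `44·(44 − 1728) ≡ 23` is a non-residue mod 47). -/
theorem sextic_D432_k0_alpha_nonsq : ¬ ∃ B Q : ℚ[X], C ((1 : ℤ) : ℚ) * (X * (X - C (1728 : ℚ))) = B ^ 2 + map (Int.castRingHom ℚ) (List.foldr (fun (c : ℤ) (P : ℤ[X]) => C c + X * P) 0 [42889619864187195342544128412237640625000000000000, 3869372376492639837782614434923625000000000000, 34904627315764077727184412247908187500000000, 1007059405271040783775694468925000000000, 280179539493990596285512318134750000, -22804995243537595825782822000, 1]) * Q := nonsqMod_of_residue _ 1 47 (by norm_num) 44 (by decide +kernel) (by decide +kernel) (by decide +kernel)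

end Summit.HodgeConjecture.HodgeConjecture.HodgeLocus.Census.SexticNeither
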